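import Mathlib
import Summits.MatrixMultiplication.Statement
import Summits.MatrixMultiplication.MatrixMultiplication.Theorems.GraphEquationsHorizontalUnmasking

/-!
# Flat persistence = two horizontal rounds (`GraphEquations`, M58)

Decomp-mm node «GraphEquations» (lens 5, g42); attacked leaf `MultiplicityReduction`
(stmt-MatrixMultiplication-27806).  Target VERBATIM: `_root_.MatrixMultiplication`.  Route-neutral.

M57 introduced the horizontal derivative `∂_{(U,V)} g` of an affine test.  The tangent-word engine (M20c)
reads `R(⟨n,n,n⟩) ≤ 2·3^{|Ξ|}·cost` off ANY base `y` at which the word-outputs along `Ξ` have full row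
rank; for `Ξ = [X_v, X_v]` (`v = (U,V)`, cost `× 9`) the word system is `S ∪ ∂_v S ∪ ∂_v∂_v S =: happend₂`.
This file identifies its kernel EXACTLY and EVERYWHERE (no genericity):

* `AffTest.jac_line` — the row map restricted to the base line `y + t v` is the quadratic
  `J_g(y) + t·J_{∂_v g}(y) + t²·M(UV)`.
* `AffSystem.PersistsAlong` — `δ ∈ K(y + t v)` for ALL `t` («`δ` persists along the line»);
  `persistsAlong_iff` — … iff `δ ∈ K(y)`, `δ ⊥ J_{∂_v g_i}(y)`, `δ ⊥ M_i(UV)` (coefficient extraction at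
  `t = 0, 1, −1`);  **`isKer_happend₂_iff`** / **`reducedAt_happend₂_iff`** — THE DICTIONARY: the kernel
  of the two-round system at `y` is `⋂_t K(y + t v)`, so TWO HORIZONTAL ROUNDS ALONG `v` PURIFY `S` AT `y`
  IFF NO NONZERO KERNEL VECTOR PERSISTS ALONG THE BASE LINE `y + ℂv`.
* `persistsAlongFlat_iff_pairwise` — persistence along the flat `y + span(v_1,…,v_d)` is the PAIRWISE
  condition: persistence along the `d + d(d−1)/2` lines `v_a`, `v_a + v_b` (the row map is quadratic).
* `Correct.eq_zero_of_persistsAlong_all` — along ALL lines through one point nothing persists (no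
  constant kernel field, M40); `PivotDesign.eq_zero_of_persistsAlong_id` — for every pivot design NOTHING
  persists along the single free line direction `(𝟙,0)` from ANY base (M57): flat-rigidity index `1`
  although the corank is `|P|` (up to `n^{3/2}/4`) identically.
So the dial replacing corank (NODE-g42 §3): the least `d` such that some base and some `d` directions
carry no persistent kernel vector — `CubicUnmask`/CEFM follow when it is `O(1)` (cost `× 9^d`), and a
cheap correct cubic family persistent along all `O(log n)`-flats from all bases would be a NEW obstruction.
Sources: [BurgisserClausenShokrollahi1997, §4.1 Rem. (4.3), (7.7), Problem 16.3];
[LeykinVerscheldeZhao2006, Thm. 3.1]; the cell's M20c/M40/M54–M57.  No `sorry`.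
-/

-- dupNamespace: forced by the nested Summit.MatrixMultiplication.MatrixMultiplication layout (D-0017)
set_option linter.dupNamespace false

noncomputable section

namespace Summit.MatrixMultiplication.MatrixMultiplication.Theorems.GraphEquations

open Matrix Module

variable {n : ℕ}

/-! ## The row map on a base line -/

namespace AffTest

variable (g : AffTest n)

/-- The gradient of the horizontal derivative is LINEAR in the direction:
`J_{∂_{(U,V)} g}(A,B) = (L_A + M∘(·B)) U + (L_B + M∘(A·)) V`. -/
theorem jac_hderiv_eq_mulVec (U V A B : Vec n) :
    (g.hderiv U V).jac A B = (g.LA + g.M * rmulOp B) *ᵥ U + (g.LB + g.M * lmulOp A) *ᵥ V := by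
  rw [jac_hderiv, add_mulVec, add_mulVec, ← mulVec_mulVec, ← mulVec_mulVec, rmulOp_mulVec,
    lmulOp_mulVec, mulVec_add]
  abel

/-- Homogeneity in the direction. -/
theorem jac_hderiv_smul (s : ℂ) (U V A B : Vec n) :
    (g.hderiv (s • U) (s • V)).jac A B = s • (g.hderiv U V).jac A B := by
  rw [jac_hderiv_eq_mulVec, jac_hderiv_eq_mulVec, mulVec_smul, mulVec_smul, smul_add]

/-- Additivity in the direction. -/
theorem jac_hderiv_add (U U' V V' A B : Vec n) :
    (g.hderiv (U + U') (V + V')).jac A B =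
      (g.hderiv U V).jac A B + (g.hderiv U' V').jac A B := by
  rw [jac_hderiv_eq_mulVec, jac_hderiv_eq_mulVec, jac_hderiv_eq_mulVec, mulVec_add, mulVec_add]
  abel

/-- Along a combination of directions. -/
theorem jac_hderiv_sum {d : ℕ} (U V : Fin d → Vec n) (t : Fin d → ℂ) (A B : Vec n) :
    (g.hderiv (∑ a, t a • U a) (∑ a, t a • V a)).jac A B =
      ∑ a, t a • (g.hderiv (U a) (V a)).jac A B := by
  rw [jac_hderiv_eq_mulVec, mulVec_sum, mulVec_sum, ← Finset.sum_add_distrib]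
  refine Finset.sum_congr rfl fun a _ => ?_
  rw [jac_hderiv_eq_mulVec, mulVec_smul, mulVec_smul, smul_add]

/-- **The row map on the base line `y + t·v` is a quadratic in `t`:**
`J_g(A + tU, B + tV) = J_g(A,B) + t·J_{∂_v g}(A,B) + t²·M(UV)`. -/
theorem jac_line (U V A B : Vec n) (t : ℂ) :
    g.jac (A + t • U) (B + t • V) =
      g.jac A B + t • (g.hderiv U V).jac A B + (t * t) • (g.M *ᵥ prodVec U V) := by
  rw [jac_add_add, jac_hderiv_smul, prodVec_smul_left, prodVec_smul_right, smul_smul, mulVec_smul]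

end AffTest

/-- The product of two combinations of directions. -/
theorem prodVec_sum_sum {d : ℕ} (U V : Fin d → Vec n) (t : Fin d → ℂ) :
    prodVec (∑ a, t a • U a) (∑ b, t b • V b) = ∑ a, ∑ b, (t a * t b) • prodVec (U a) (V b) := by
  rw [← rmulOp_mulVec, mulVec_sum]
  refine Finset.sum_congr rfl fun a _ => ?_
  rw [mulVec_smul, rmulOp_mulVec, ← lmulOp_mulVec, mulVec_sum, Finset.smul_sum]
  refine Finset.sum_congr rfl fun b _ => ?_
  rw [mulVec_smul, lmulOp_mulVec, smul_smul]

/-! ## Persistence along a base line = the kernel of two horizontal rounds -/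

namespace AffSystem

variable (S : AffSystem n)

/-- `δ` PERSISTS along the base line through `(A,B)` in direction `v = (U,V)`: it is a kernel vector at
every point of the line. -/
def PersistsAlong (A B U V δ : Vec n) : Prop := ∀ t : ℂ, S.IsKer (A + t • U) (B + t • V) δ

/-- The two-round horizontal system along `v`: `S ∪ ∂_v S ∪ ∂_v S ∪ ∂_v∂_v S` (the word system of
`Ξ = [X_v, X_v]`; cost `× 9` in Ostrowski's model, M20c). -/
def happend₂ (U V : Vec n) : AffSystem n := (S.happend U V).happend U V

variable {S}

/-- **Persistence, coefficient by coefficient**: `δ` persists along the line iff `δ ∈ K(A,B)`,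
`δ ⊥ J_{∂_v g_i}(A,B)` and `δ ⊥ M_i(UV)` for every test (`t = 0, 1, −1` suffice). -/
theorem persistsAlong_iff {A B U V δ : Vec n} :
    S.PersistsAlong A B U V δ ↔
      S.IsKer A B δ ∧ (∀ i, ((S.test i).hderiv U V).jac A B ⬝ᵥ δ = 0) ∧
        ∀ i, ((S.test i).M *ᵥ prodVec U V) ⬝ᵥ δ = 0 := by
  constructor
  · intro h
    have h0 : S.IsKer A B δ := by simpa using h 0
    have key : ∀ i, ((S.test i).hderiv U V).jac A B ⬝ᵥ δ = 0 ∧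
        ((S.test i).M *ᵥ prodVec U V) ⬝ᵥ δ = 0 := fun i => by
      have h1 := h 1 i
      have h2 := h (-1) i
      rw [AffTest.jac_line, add_dotProduct, add_dotProduct, smul_dotProduct, smul_dotProduct, h0 i,
        zero_add, smul_eq_mul, smul_eq_mul] at h1 h2
      constructor
      · linear_combination (h1 - h2) / 2
      · linear_combination (h1 + h2) / 2
    exact ⟨h0, fun i => (key i).1, fun i => (key i).2⟩
  · rintro ⟨h0, h1, h2⟩ t i
    rw [AffTest.jac_line, add_dotProduct, add_dotProduct, smul_dotProduct, smul_dotProduct, h0 i, h1 i,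
      h2 i, smul_zero, smul_zero, add_zero, add_zero]

/-- Persistence does not depend on the base point chosen on the line. -/
theorem PersistsAlong.shift {A B U V δ : Vec n} (h : S.PersistsAlong A B U V δ) (s : ℂ) :
    S.PersistsAlong (A + s • U) (B + s • V) U V δ := fun t => by
  have := h (s + t)
  rwa [add_smul, add_smul, ← add_assoc, ← add_assoc] at this

/-- Persistence is homogeneous in the direction. -/
theorem PersistsAlong.smul {A B U V δ : Vec n} (h : S.PersistsAlong A B U V δ) (s : ℂ) :
    S.PersistsAlong A B (s • U) (s • V) δ := fun t => by
  have := h (t * s)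
  rwa [mul_smul, mul_smul] at this

/-- **THE DICTIONARY.**  The kernel of the two-round horizontal system along `v = (U,V)` at `(A,B)` is
exactly the space of kernel vectors of `S` persisting along the base line `(A,B) + ℂv`. -/
theorem isKer_happend₂_iff {A B U V δ : Vec n} :
    (S.happend₂ U V).IsKer A B δ ↔ S.PersistsAlong A B U V δ := by
  rw [happend₂, isKer_happend_iff, isKer_happend_iff, persistsAlong_iff]
  constructor
  · rintro ⟨⟨h0, h1⟩, h2⟩
    refine ⟨h0, h1, fun i => ?_⟩
    have := h2 (Fin.natAdd S.m i)
    rw [happend_test_right, AffTest.jac_hderiv_hderiv, ← two_smul ℂ, mulVec_smul, smul_dotProduct,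
      smul_eq_zero] at this
    exact this.resolve_left two_ne_zero
  · rintro ⟨h0, h1, h2⟩
    refine ⟨⟨h0, h1⟩, fun j => ?_⟩
    induction j using Fin.addCases with
    | left i => rw [happend_test_left]; exact h1 i
    | right i =>
      rw [happend_test_right, AffTest.jac_hderiv_hderiv, ← two_smul ℂ, mulVec_smul, smul_dotProduct,
        h2 i, smul_zero]

/-- **Two horizontal rounds along `v` purify `S` at `y` iff no nonzero kernel vector persists along the
base line `y + ℂv`.** -/
theorem reducedAt_happend₂_iff {A B U V : Vec n} :
    (S.happend₂ U V).ReducedAt A B ↔ ∀ δ, S.PersistsAlong A B U V δ → δ = 0 := by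
  simp only [ReducedAt, isKer_happend₂_iff]

/-- The two-round system of a correct system is correct. -/
theorem Correct.happend₂ (hC : S.Correct) (U V : Vec n) : (S.happend₂ U V).Correct :=
  (hC.happend U V).happend U V

/-- A persistent vector is in particular in the kernel of the ONE-round system. -/
theorem PersistsAlong.isKer_happend {A B U V δ : Vec n} (h : S.PersistsAlong A B U V δ) :
    (S.happend U V).IsKer A B δ :=
  isKer_happend_iff.mpr ⟨(persistsAlong_iff.mp h).1, (persistsAlong_iff.mp h).2.1⟩

/-- Hence: if one round along `v` purifies at `y`, nothing persists along `y + ℂv`. -/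
theorem eq_zero_of_persistsAlong_of_reducedAt_happend {A B U V δ : Vec n}
    (hred : (S.happend U V).ReducedAt A B) (h : S.PersistsAlong A B U V δ) : δ = 0 :=
  hred δ h.isKer_happend

/-- **Nothing persists along ALL lines through a point** (a correct system has no constant kernel
field, M40): with all `2n²` directions two rounds purify everywhere — the trivial end of the dial. -/
theorem Correct.eq_zero_of_persistsAlong_all (hC : S.Correct) {A B δ : Vec n}
    (h : ∀ U V, S.PersistsAlong A B U V δ) : δ = 0 := by
  by_contra hδ
  refine not_correct_of_const_ker hδ (fun A' B' => ?_) hC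
  have := h (A' - A) (B' - B) 1
  simpa using this

/-! ## Persistence along a flat is a pairwise condition -/

/-- `δ` persists along the flat `(A,B) + span{v_a = (U_a,V_a)}`. -/
def PersistsAlongFlat (S : AffSystem n) {d : ℕ} (A B : Vec n) (U V : Fin d → Vec n) (δ : Vec n) :
    Prop :=
  ∀ t : Fin d → ℂ, S.IsKer (A + ∑ a, t a • U a) (B + ∑ a, t a • V a) δ

/-- Lines inside a persistent flat are persistent. -/
theorem PersistsAlongFlat.line {d : ℕ} {A B : Vec n} {U V : Fin d → Vec n} {δ : Vec n}
    (h : S.PersistsAlongFlat A B U V δ) (w : Fin d → ℂ) :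
    S.PersistsAlong A B (∑ a, w a • U a) (∑ a, w a • V a) δ := fun t => by
  have := h (fun a => t * w a)
  simp only [mul_smul, ← Finset.smul_sum] at this
  exact this

/-- **Flat persistence is pairwise**: `δ` persists along the flat spanned by `v_1, …, v_d` iff it is a
kernel vector at the base point and persists along the lines `v_a` and `v_a + v_b` (the row map is
quadratic in the base, `AffTest.jac_line`). -/
theorem persistsAlongFlat_iff_pairwise {d : ℕ} {A B : Vec n} {U V : Fin d → Vec n} {δ : Vec n} :
    S.PersistsAlongFlat A B U V δ ↔
      S.IsKer A B δ ∧ (∀ a, S.PersistsAlong A B (U a) (V a) δ) ∧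
        ∀ a b, S.PersistsAlong A B (U a + U b) (V a + V b) δ := by
  classical
  constructor
  · intro h
    refine ⟨by simpa using h 0, fun a => ?_, fun a b => ?_⟩
    · have := h.line (Pi.single a 1)
      simpa [Pi.single_apply] using this
    · have := h.line (Pi.single a 1 + Pi.single b 1)
      simpa [Pi.single_apply, add_smul, Finset.sum_add_distrib] using this
  · rintro ⟨h0, h1, h2⟩ t i
    set g := S.test i with hg
    -- the symmetrised second-order pairings vanish
    set x : Fin d → Fin d → ℂ := fun a b => (g.M *ᵥ prodVec (U a) (V b)) ⬝ᵥ δ with hx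
    have hsym : ∀ a b, x a b + x b a = 0 := fun a b => by
      have hab := (persistsAlong_iff.mp (h2 a b)).2.2 i
      have ha := (persistsAlong_iff.mp (h1 a)).2.2 i
      have hb := (persistsAlong_iff.mp (h1 b)).2.2 i
      rw [prodVec_add_add, mulVec_add, mulVec_add, mulVec_add, add_dotProduct, add_dotProduct,
        add_dotProduct] at hab
      rw [← hg] at ha hb hab
      simp only [hx]
      linear_combination hab - ha - hb
    have hlin : ∀ a, (g.hderiv (U a) (V a)).jac A B ⬝ᵥ δ = 0 := fun a => by
      have := (persistsAlong_iff.mp (h1 a)).2.1 i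
      rwa [← hg] at this
    show g.jac _ _ ⬝ᵥ δ = 0
    rw [AffTest.jac_add_add, AffTest.jac_hderiv_sum, prodVec_sum_sum, add_dotProduct, add_dotProduct]
    have e0 : g.jac A B ⬝ᵥ δ = 0 := by have := h0 i; rwa [← hg] at this
    have e1 : (∑ a, t a • (g.hderiv (U a) (V a)).jac A B) ⬝ᵥ δ = 0 := by
      rw [sum_dotProduct]
      exact Finset.sum_eq_zero fun a _ => by rw [smul_dotProduct, hlin a, smul_zero]
    have e2 : (g.M *ᵥ ∑ a, ∑ b, (t a * t b) • prodVec (U a) (V b)) ⬝ᵥ δ =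
        ∑ a, ∑ b, t a * t b * x a b := by
      rw [mulVec_sum, sum_dotProduct]
      refine Finset.sum_congr rfl fun a _ => ?_
      rw [mulVec_sum, sum_dotProduct]
      refine Finset.sum_congr rfl fun b _ => ?_
      rw [mulVec_smul, smul_dotProduct, smul_eq_mul]
    rw [e0, e1, e2, zero_add, zero_add]
    have h2S : (∑ a, ∑ b, t a * t b * x a b) + ∑ a, ∑ b, t a * t b * x a b = 0 := by
      conv_lhs => enter [2]; rw [Finset.sum_comm]
      rw [← Finset.sum_add_distrib]
      refine Finset.sum_eq_zero fun a _ => ?_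
      rw [← Finset.sum_add_distrib]
      refine Finset.sum_eq_zero fun b _ => ?_
      linear_combination (t a * t b) * hsym a b
    linear_combination h2S / 2

/-- Persistence along the flat of ALL directions forces `δ = 0` for a correct system. -/
theorem Correct.eq_zero_of_persistsAlongFlat_all (hC : S.Correct) {d : ℕ} {A B : Vec n}
    {U V : Fin d → Vec n} (hspan : ∀ U' V' : Vec n, ∃ w : Fin d → ℂ,
      (∑ a, w a • U a) = U' ∧ (∑ a, w a • V a) = V')
    {δ : Vec n} (h : S.PersistsAlongFlat A B U V δ) : δ = 0 :=
  hC.eq_zero_of_persistsAlong_all fun U' V' => by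
    obtain ⟨w, hU, hV⟩ := hspan U' V'
    rw [← hU, ← hV]
    exact h.line w

end AffSystem

/-! ## Pivot designs: nothing persists along the free line `(𝟙, 0)`, from any base -/

namespace PivotDesign

variable (D : PivotDesign n)

/-- **Flat-rigidity index one.**  For every pivot design and every base point, no nonzero kernel vector
persists along the line in direction `(𝟙,0)` (one round already purifies, M57) — although the corank is
`|P|` at every point (M56). -/
theorem eq_zero_of_persistsAlong_id {A B δ : Vec n} (h : D.system.PersistsAlong A B idFun 0 δ) :
    δ = 0 :=
  AffSystem.eq_zero_of_persistsAlong_of_reducedAt_happend (D.reducedAt_happend_id A B) h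

/-- The two-round system along `(𝟙,0)` of a design is reduced everywhere (and correct). -/
theorem reducedAt_happend₂_id (A B : Vec n) : (D.system.happend₂ idFun 0).ReducedAt A B :=
  AffSystem.reducedAt_happend₂_iff.mpr fun _ h => D.eq_zero_of_persistsAlong_id h

/-- … and correct. -/
theorem happend₂_id_correct : (D.system.happend₂ idFun 0).Correct :=
  D.system_correct.happend₂ _ _

end PivotDesign

end Summit.MatrixMultiplication.MatrixMultiplication.Theorems.GraphEquations

end
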